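import Literature.NumberTheory.GaloisRepresentations.UnramifiedLiftingRing
import Literature.NumberTheory.GaloisRepresentations.UnramifiedDatum
import HarnessLib

/-!
# Crystalline deformation rings for the `F̂_nr` datum

For the `p`-adic Hodge datum `unramifiedPstWeilDeligneData K p` (period ring the completed
maximal unramified extension, `UnramifiedDatum`) "crystalline" means "unramified"
(`unramifiedPstWeilDeligneData_isCrystallineFramed_iff`) and "de Rham with weights in `[a, b]`"
means "unramified, and `a ≤ 0 ≤ b` unless `n = 0`"
(`unramifiedPstWeilDeligneData_isDeRhamWithWeightsIn_iff`).  Hence the universal unramified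
framed deformation ring `𝒪_L⟦X_{ij}⟧` (`unramifiedLiftingRing`) is a crystalline deformation ring
in the sense of `CrystallineDeformationRing`, and we PROVE

* `unramifiedPstWeilDeligneData_hasCrystallineDeformationRings` —
  `(unramifiedPstWeilDeligneData K p).HasCrystallineDeformationRings`.

No named facts, no `sorry`.

## References

* M. Kisin, *Potentially semi-stable deformation rings*, JAMS 21 (2008), (3.3.3), (3.3.8). [Kisin2007]
-/

noncomputable section

open IsLocalRing Field ValuativeRel
open scoped MatrixGroups

namespace Literature.NumberTheory.GaloisRepresentations

open IsNonarchimedeanLocalField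

variable (K : Type) [Field K] [ValuativeRel K] [TopologicalSpace K] [IsNonarchimedeanLocalField K]
  (p : ℕ) [Fact p.Prime] [Algebra ℚ_[p] K]

/-- **The `F̂_nr` datum admits crystalline deformation rings** (interval form): for every
`L`, `n`, `ρ̄ : Γ_K → GL_n(k_L)` admitting a crystalline (= unramified) lift with weights in
`[a, b]`, the ring `𝒪_L⟦X_{ij}⟧` with its universal unramified lift is a
`CrystallineDeformationRing`. [cite: Kisin2007, (3.3.3) and (3.3.8)] -/
theorem unramifiedPstWeilDeligneData_hasCrystallineDeformationRings :
    (unramifiedPstWeilDeligneData K p).HasCrystallineDeformationRings := by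
  intro L _ n ρbar a b h
  letI := intermediateFieldIntegers.algebraPadicAlgCl L
  letI : TopologicalSpace (ResidueField (intermediateFieldIntegers p L)) := ⊥
  haveI : IsScalarTower (intermediateFieldIntegers p L) L (PadicAlgCl p) := IsScalarTower.of_algebraMap_eq fun _ => rfl
  haveI : DiscreteTopology (ResidueField (intermediateFieldIntegers p L)) := ⟨rfl⟩
  obtain ⟨ρ, hred, hcrys, hdR⟩ := h
  have hunr : ρ.IsLocallyUnramified := (unramifiedPstWeilDeligneData_isCrystallineFramed_iff ρ).1 hcrys
  have hρbar : ρbar.IsLocallyUnramified := isLocallyUnramified_of_reducesTo L hred hunr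
  have hQ : n = 0 ∨ (a ≤ 0 ∧ 0 ≤ b) := ((unramifiedPstWeilDeligneData_isDeRhamWithWeightsIn_iff ρ a b).1 hdR).2
  refine ⟨PointwiseLiftingRing.congr (fun ρ' => ?_) (unramifiedLiftingRing L ρbar hρbar _ hQ)⟩
  rw [unramifiedPstWeilDeligneData_isCrystallineFramed_iff, unramifiedPstWeilDeligneData_isDeRhamWithWeightsIn_iff]
  tauto

end Literature.NumberTheory.GaloisRepresentations

end
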